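import Summits.BirchSwinnertonDyer.BirchSwinnertonDyer.Theorems.SemiOrdinaryEisensteinDescentShaTwoCochainLocalVanishing
import Summits.BirchSwinnertonDyer.BirchSwinnertonDyer.Theorems.SemiOrdinaryEisensteinDescentShaTwoCochainLocalJoin
import Literature.NumberTheory.GaloisCohomology.PoitouTateOddLevelRealPlaces
import HarnessLib

/-!
# The Ш²-cochain bridge, final glue — the local invariants of the bridge's idèle cocycle VANISH in sum:
# `Σ_{v ∈ T} inv_{K_v} [π_v Z|_{Γ_v}] = 0` over every large finite set of finite places, under `hPTc`'s hypothesis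

Route `SemiOrdinaryEisensteinDescent` (BSD, rung W-ALL row 2·3@3), Kolyvagin column, Cassels–Tate lane: print item
`CasselsTateLevelInputsFact` (stmt-BirchSwinnertonDyer-20191).  Sequel of `…ShaTwoCochainLocalVanishing` (p640244: every admissible
choice for `(F♭, γ)` in `μ`-currency has a produced support and zero canonical sum) and of w3 g7's `…ShaTwoCochainLocalCurrency`
(p640894: `inv_{K_v} ((μ-iso ≫ κ_v)_* x) = (canonical_v x)/n`, pointwise recognition of push-forwards).  The μ-currency package
`…ShaTwoCochainBridgePackageMu` (p641526, conjunct (6♭)) compares, at each place, the bridge's `μₙ`-valued local `2`-cocycle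
`c_v = φ♭_v ∪ γ_v − H♭_v` with the idèle projection of its idèle cocycle: `ι_v κ (c_v) = π_v Z|_{Γ_v} − dλ_v` ON THE NOSE.  Here:

* **`sum_brauerInvariantEquiv_localProjection_eq_zero_of_hPTc`** — for `f` with `hPTc`'s hypothesis (THE maps, odd level
  `n = m²`), `F♭` with `θ′_* [f] = [F♭]`, `γ` locally trivial, an admissible `μ`-choice `(H♭; φ♭_v)` for `(F♭, γ)` (shapes (2♭)/(6♭)),
  an idèle `2`-cocycle `Z` with idèle projections `π_v` and local projection cocycles `c_v(s,t) = π_v Z(θs, θt)` at the finite places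
  satisfying the bridge identity (6♭): there is a finite set `S₀` of finite places such that **`Σ_{v ∈ T} inv_{K_v} [c_v] = 0` for
  every finite `T ⊇ S₀`** — glue-L's produced support (`evFlip_support_and_sum_eq_zero_of_class_eq`, p640244), the archimedean
  terms vanishing at odd level (`LocalInvariants.canonical_inl_eq_zero_of_odd`), and w3 g7's per-place join
  `brauerInvariantEquiv_localProjection_eq_zmodToQmodZ_canonical` (`…ShaTwoCochainLocalJoin`, p641898) termwise.

This is the vanishing of the sum of local invariants of the bridge's idèle cocycle; S3b (w2 g11) reads that sum as
`classBarInv(Φ⁻¹[γ] ∘ ∂h)`, which closes the binder `hbridge` of `…ShaTwoCochainShell`.  THEOREMS ONLY (no definition, no instance,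
no named fact); no case of BSD, Poitou–Tate or Cassels–Tate is proved here.  Width seat `bsd-wall-soed-p2-w4` g2;
`--supports stmt-BirchSwinnertonDyer-20480`, helper; route-free.

## References
* [MilneADT2006] J. S. Milne, *Arithmetic Duality Theorems*, 2nd ed. (2006), Ch. I §1 (`inv_v`), Ex. 1.6 (b)(c), Thm. 4.10 (a)
  (proof, p. 58), §6 proof of Prop. 6.9.
* [CasselsFrohlichANT1967] J. W. S. Cassels, A. Fröhlich (eds.), *Algebraic Number Theory* (1967), Ch. VI §1.1, Ch. VII §11.2.
-/

noncomputable section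

open scoped Classical

-- `Summit.<P>.<Sub>` repeats `BirchSwinnertonDyer` by the tree's layout convention (D-0017)
set_option linter.dupNamespace false
set_option autoImplicit false

namespace Summit.BirchSwinnertonDyer.BirchSwinnertonDyer.Theorems.ShaTwoCochainTheta

open CategoryTheory _root_.WeierstrassCurve Field Function NumberField IsDedekindDomain
open Literature.NumberTheory.EllipticCurves
open Literature.NumberTheory.GaloisRepresentations Literature.NumberTheory.GaloisCohomology
open Literature.NumberTheory.GaloisRepresentations.DiscreteGaloisModule (mu MuCarrier units UnitsCarrier TateDual tateDual
  tateDualPairing pairingDualHom pairingDualIntertwining)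
open Literature.NumberTheory.GaloisRepresentations.HomDual (unitsTransferAddHom)
open Literature.Algebra.Homology Literature.Algebra.Homology.DiscreteRep
open Literature.NumberTheory.GaloisRepresentations.DGMBridge
open Literature.NumberTheory.GaloisRepresentations.IdeleClassBar (classBarD)
open Literature.AnabelianGeometry.AbsoluteAnabelian (Prop121vii.brauerInvariantEquiv Prop121vii.zmodToQmodZ)
open Summit.BirchSwinnertonDyer.BirchSwinnertonDyer.Theorems.ShaTwoCochain
open scoped ContRepresentation NumberField

variable {K : Type} [Field K] [NumberField K]

/-! ## The sum of the finite-place invariants of `π_v Z` vanishes under `hPTc`'s hypothesis -/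

section Sum

variable {W : WeierstrassCurve K} {m : ℕ} [NeZero m]
variable {e : geomTorsion W ((m * m : ℕ) : ℤ) → geomTorsion W ((m * m : ℕ) : ℤ) → AlgebraicClosure K}
  {hμ : ∀ S T, e S T ^ (m * m) = 1}
  {hadd₁ : ∀ S₁ S₂ T, e (S₁ + S₂) T = e S₁ T * e S₂ T}
  {hadd₂ : ∀ S T₁ T₂, e S (T₁ + T₂) = e S T₁ * e S T₂}
  {hgal : ∀ (σ : absoluteGaloisGroup K) (S T : geomTorsion W ((m * m : ℕ) : ℤ)), σ • e S T = e (σ • S) (σ • T)}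
variable [Finite (geomTorsion W (m : ℤ))] [NeZero (m * m)]

/-- **`Σ_{v ∈ T} inv_{K_v} [π_v Z|_{Γ_v}] = 0` over every large finite set `T` of finite places** — for a `2`-cocycle `f` of
`E[m]` with `hPTc`'s hypothesis (THE maps, level `m²` ODD), `F♭` with `θ′_* [f] = [F♭]`, a locally trivial `γ`, an admissible
`μ`-choice `(H♭; φ♭_v)` for `(F♭, γ)` (shapes (2♭)/(6♭) of `exists_bridgePackageMu`), an idèle `2`-cocycle `Z`, idèle projections `π_v`
and local projection cocycles `c_v` (`c_v(s,t) = π_v Z(θs, θt)`, w2 g11's / w3 g7's format) at the finite places with the bridge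
identity (6♭) `ι_v κ (φ♭_v ∪ γ_v − H♭_v) = π_v Z|_v − dλ_v`.  Proof: glue-L produces a finite `S′ ⊆ Place K` off which the canonical
terms of `(H♭; φ♭_v)` vanish and over which they sum to `0`; at infinite places the terms vanish anyway at odd level; so over any
finite `T ⊇ S′ ∩ {finite}` the finite-place canonical terms sum to `0`; termwise `inv_{K_v} [c_v] = zmodToQmodZ (canonical_v [·])`
(the local join). [cite: MilneADT2006, Ch. I Thm. 4.10 (a) (proof, p. 58), §1 Ex. 1.6 (b)(c), §6 proof of Prop. 6.9] -/
theorem sum_brauerInvariantEquiv_localProjection_eq_zero_of_hPTc (hodd : Odd (m * m))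
    {f : contTwoCocycles (W.torsionGaloisModule (m : ℤ)).toTopRep}
    (hf : ∀ g : contOneCocycles (W.torsionGaloisModule (m : ℤ)).toTopRep,
      (∀ v : Place K, locClass (W.torsionGaloisModule (m : ℤ)) (Place.Completion v)
          (resOne (W.torsionGaloisModule (m : ℤ)) (Place.Completion v) g) = 0) →
      ∃ (C : PTChoice W m e hμ hadd₁ hadd₂ hgal f g) (S : Finset (Place K)),
        (∀ v ∉ S, C.localTerm (LocalInvariants.canonical K (m * m)) v = 0) ∧
          ∑ v ∈ S, C.localTerm (LocalInvariants.canonical K (m * m)) v = 0)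
    (Fb : contTwoCocycles ((W.torsionGaloisModule (m : ℤ)).tateDual (m * m)).toTopRep)
    (hclass : galoisCohomology.map (pairingDualIntertwining
        (ρ₁ := W.torsionGaloisModule (m : ℤ)) (ρ₂ := W.torsionGaloisModule (m : ℤ))
        (B := (descendHom W m m e hμ hadd₁ hadd₂).flip) (descendHom_flip_smul W m e hμ hadd₁ hadd₂ hgal)) 2
        (twoCocycleClass _ f) = twoCocycleClass _ Fb)
    {γ : contOneCocycles (W.torsionGaloisModule (m : ℤ)).toTopRep}
    (hγ : ∀ v : Place K, locClass (W.torsionGaloisModule (m : ℤ)) (Place.Completion v)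
      (resOne (W.torsionGaloisModule (m : ℤ)) (Place.Completion v) γ) = 0)
    (Hb : C(absoluteGaloisGroup K × absoluteGaloisGroup K, MuCarrier K (m * m)))
    (hHb : ∀ σ τ υ : absoluteGaloisGroup K,
      (((tateDualPairing (W.torsionGaloisModule (m : ℤ)) (m * m)).flip).cupCocycle₂₁ Fb γ).1 (σ, τ, υ) =
        dTwo (mu K (m * m)).toTopRep Hb σ τ υ)
    (φb : (v : Place K) → C(absoluteGaloisGroup (Place.Completion v), TateDual K (geomTorsion W (m : ℤ)) (m * m)))
    (hφb : ∀ (v : Place K) (σ' τ' : absoluteGaloisGroup (Place.Completion v)),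
      (resTwo ((W.torsionGaloisModule (m : ℤ)).tateDual (m * m)) (Place.Completion v) Fb).1 (σ', τ') =
        (DiscreteGaloisModule.toTopRep (GaloisRep.restrictField (Place.Completion v)
            ((W.torsionGaloisModule (m : ℤ)).tateDual (m * m)))).ρ σ' (φb v τ') - φb v (σ' * τ') + φb v σ')
    (Z : contTwoCocycles (toDGM (ideleBarD K)).toTopRep)
    (π : (v : HeightOneSpectrum (𝓞 K)) → HomDual.IdeleProjection K (Sum.inr v))
    (cZ : (v : HeightOneSpectrum (𝓞 K)) → contTwoCocycles (units (v.adicCompletion K)).toTopRep)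
    (hcZ : ∀ (v : HeightOneSpectrum (𝓞 K)) (s t : absoluteGaloisGroup (v.adicCompletion K)),
      (cZ v).1 (s, t) = ((π v).toAddMonoidHom.comp (LCarrier.val (ideleBarD K)))
        (Z.1 (absGaloisRestrict K (v.adicCompletion K) s, absGaloisRestrict K (v.adicCompletion K) t)))
    (lam : (v : HeightOneSpectrum (𝓞 K)) →
      C(absoluteGaloisGroup (Place.Completion (Sum.inr v : Place K)), UnitsCarrier (Place.Completion (Sum.inr v : Place K))))
    (h6 : ∀ (v : HeightOneSpectrum (𝓞 K)) (σ' τ' : absoluteGaloisGroup (Place.Completion (Sum.inr v : Place K))),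
      unitsTransferAddHom K (Place.Completion (Sum.inr v : Place K)) (kummerInclAddHom K (m * m)
          ((show MuCarrier K (m * m) from
              (φb (Sum.inr v) σ') ((W.torsionGaloisModule (m : ℤ)) (absGaloisRestrict K (Place.Completion (Sum.inr v : Place K)) σ')
                (γ.1 (absGaloisRestrict K (Place.Completion (Sum.inr v : Place K)) τ')))) -
            Hb (absGaloisRestrict K (Place.Completion (Sum.inr v : Place K)) σ',
              absGaloisRestrict K (Place.Completion (Sum.inr v : Place K)) τ'))) =
        ((π v).toAddMonoidHom.comp (LCarrier.val (ideleBarD K)))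
            (Z.1 (absGaloisRestrict K (Place.Completion (Sum.inr v : Place K)) σ',
              absGaloisRestrict K (Place.Completion (Sum.inr v : Place K)) τ')) -
          (units (Place.Completion (Sum.inr v : Place K)) σ' (lam v τ') - lam v (σ' * τ') + lam v σ')) :
    ∃ S₀ : Finset (HeightOneSpectrum (𝓞 K)), ∀ T : Finset (HeightOneSpectrum (𝓞 K)), S₀ ⊆ T →
      ∑ v ∈ T, (haveI := charZero_adicCompletion v; haveI := absoluteGaloisGroup_compactSpace (v.adicCompletion K);
        Prop121vii.brauerInvariantEquiv (v.adicCompletion K) (twoCocycleClass (units (v.adicCompletion K)).toTopRep (cZ v))) = 0 := by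
  haveI := absoluteGaloisGroup_compactSpace K
  -- glue-L: produced support and zero canonical sum for the `μ`-choice `(H♭; φ♭_v)`
  obtain ⟨S', hoff, hsum⟩ :=
    evFlip_support_and_sum_eq_zero_of_class_eq (hgal := hgal) hf Fb hclass hγ Hb hHb φb hφb
  refine ⟨S'.toRight, fun T hT => ?_⟩
  -- the canonical local term at a place `u`
  let t : Place K → ZMod (m * m) := fun u => LocalInvariants.canonical K (m * m) u
      (locClass₂ (mu K (m * m)) (Place.Completion u)
        ((((tateDualPairing (W.torsionGaloisModule (m : ℤ)) (m * m)).flip).restrict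
            (absGaloisRestrict K (Place.Completion u))).cupSubCocycle (φb u)
          (resOne (W.torsionGaloisModule (m : ℤ)) (Place.Completion u) γ)
          (resTwo ((W.torsionGaloisModule (m : ℤ)).tateDual (m * m)) (Place.Completion u) Fb) (hφb u)
          (resCochain₂ (Place.Completion u) Hb)
          (dTwo_resCochain₂_of_cupCocycle₂₁ ((tateDualPairing (W.torsionGaloisModule (m : ℤ)) (m * m)).flip)
            (fun w => ((tateDualPairing (W.torsionGaloisModule (m : ℤ)) (m * m)).flip).restrict
              (absGaloisRestrict K (Place.Completion w)))
            (fun _ _ _ => rfl) Hb hHb u)))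
  -- termwise join at the finite places
  have hterm : ∀ v : HeightOneSpectrum (𝓞 K),
      (haveI := charZero_adicCompletion v; haveI := absoluteGaloisGroup_compactSpace (v.adicCompletion K);
        Prop121vii.brauerInvariantEquiv (v.adicCompletion K) (twoCocycleClass (units (v.adicCompletion K)).toTopRep (cZ v))) =
      Prop121vii.zmodToQmodZ (m * m) (t (Sum.inr v)) := fun v =>
    brauerInvariantEquiv_localProjection_eq_zmodToQmodZ_canonical (W.torsionGaloisModule (m : ℤ)) (m * m) v Fb γ Hb hHb
      (φb (Sum.inr v)) (hφb (Sum.inr v)) (lam v) Z (π v) (cZ v) (hcZ v) (h6 v)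
  -- infinite places contribute zero at odd level; places off `S′` contribute zero
  have hzero : ∀ u : Place K, u ∈ S' ∪ T.map ⟨Sum.inr, Sum.inr_injective⟩ → u ∉ T.map ⟨Sum.inr, Sum.inr_injective⟩ →
      t u = 0 := by
    rintro (w | v) hu' hu
    · exact LocalInvariants.canonical_inl_eq_zero_of_odd hodd w _
    · exfalso
      rcases Finset.mem_union.1 hu' with h | h
      · exact hu (Finset.mem_map.2 ⟨v, hT (Finset.mem_toRight.2 h), rfl⟩)
      · exact hu h
  have key : ∑ v ∈ T, t (Sum.inr v) = 0 :=
    calc ∑ v ∈ T, t (Sum.inr v)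
        = ∑ u ∈ T.map ⟨Sum.inr, Sum.inr_injective⟩, t u := (Finset.sum_map T ⟨Sum.inr, Sum.inr_injective⟩ t).symm
      _ = ∑ u ∈ S' ∪ T.map ⟨Sum.inr, Sum.inr_injective⟩, t u :=
          Finset.sum_subset Finset.subset_union_right fun u hu' hu => hzero u hu' hu
      _ = ∑ u ∈ S', t u :=
          (Finset.sum_subset Finset.subset_union_left fun u _ hu => hoff u hu).symm
      _ = 0 := hsum
  calc ∑ v ∈ T, (haveI := charZero_adicCompletion v; haveI := absoluteGaloisGroup_compactSpace (v.adicCompletion K);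
          Prop121vii.brauerInvariantEquiv (v.adicCompletion K) (twoCocycleClass (units (v.adicCompletion K)).toTopRep (cZ v)))
      = ∑ v ∈ T, Prop121vii.zmodToQmodZ (m * m) (t (Sum.inr v)) := Finset.sum_congr rfl fun v _ => hterm v
    _ = Prop121vii.zmodToQmodZ (m * m) (∑ v ∈ T, t (Sum.inr v)) := (map_sum _ _ _).symm
    _ = 0 := by rw [key, map_zero]

end Sum

end Summit.BirchSwinnertonDyer.BirchSwinnertonDyer.Theorems.ShaTwoCochainTheta

end
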